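import Mathlib.NumberTheory.Padics.RingHoms
import Mathlib.Tactic.NormNum.Prime
import Mathlib.Topology.Algebra.Valued.NormedValued
import Literature.NumberTheory.EllipticCurves.Curve24A1Descent
import Literature.NumberTheory.EllipticCurves.PointReduction
import HarnessLib

/-!
# Kubert (1976), no `ℤ/2ℤ × ℤ/12ℤ` in `E(ℚ)`: discharge, through the rational points of `24A1`

Sibling proof file of `Literature.NumberTheory.EllipticCurves.MazurTorsion` (named fact
`Kubert1976_no_two_twelve W`: an elliptic curve over `ℚ` has no subgroup `ℤ/2ℤ × ℤ/12ℤ` in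
`E(ℚ)`; D. S. Kubert, *Universal bounds on the torsion of elliptic curves*, Proc. London Math.
Soc. (3) 33 (1976) 193–237, Ch. IV — the modular curve `X₁(2,12)` has only cuspidal rational
points — quoted by Mazur 1977, Ch. III §5, p. 156) and of
`Literature.NumberTheory.EllipticCurves.KubertTwoTwelve` (which PROVES the reduction
`Kubert1976_no_two_twelve_of_points_24A1` of that fact to the named fact
`Cremona1997_points_24A1`: the rational points of `24A1 : y² = x³ - x² - 4x + 4` are the eight
listed ones; Cremona, *Algorithms for Modular Elliptic Curves*, Table 1, `N = 24`, curve `A1`,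
`r = 0`, `|T| = 8`). This file DISCHARGES both:

* `Literature.NumberTheory.EllipticCurves.Cremona1997_points_24A1_holds : Cremona1997_points_24A1`;
* `Literature.NumberTheory.EllipticCurves.Kubert1976_no_two_twelve_holds W : Kubert1976_no_two_twelve W`
  for every `W : WeierstrassCurve ℚ`.

## The proof (all in the tree, sorry-free)

1. **Rank `0`**: `E(ℚ)` is finite for `E = 24A1` — the complete `2`-descent of
   `Curve24A1Descent.lean` (`Curve24A1.finite_point`; Silverman, *AEC*, Prop. X.1.4, Ex. X.1.5,
   with the tree's Mordell–Weil theorem).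
2. **`#E(ℚ) ≤ 8`** (`Curve24A1.natCard_point_le_eight`): `24A1` has good reduction at `5` and `7`
   (`Δ = 2304 = 2⁸3²`) with `#Ẽ(𝔽₅) = #Ẽ(𝔽₇) = 8` (`natCard_point_reduction_five/seven`, by
   enumeration of the affine solutions, `decide`); the prime-to-`ℓ` torsion of `E(ℚ)` injects
   into `Ẽ(𝔽_ℓ)` (Silverman, *AEC*, Prop. VII.3.1(b); the tree's
   `Literature.NumberTheory.EllipticCurves.injective_reduceHom`, `PointReduction.lean`, applied
   to the `ℓ`-adic absolute value of `ℚ` and the residue map `ℤ_(ℓ) → ℤ_ℓ → 𝔽_ℓ`,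
   `exists_reduceHom`). For `P ∈ E(ℚ)` of order `n = 5ᵃm`, `5 ∤ m`, the point `mP` is killed by
   `5ᵃ`, hence lies in the prime-to-`7` torsion, hence is killed by `#Ẽ(𝔽₇) = 8`; so `8m P = 0`
   and `P` lies in the prime-to-`5` torsion: all of `E(ℚ)` injects into `Ẽ(𝔽₅)`.
3. **The eight points**: `O, (1,0), (2,0), (-2,0), (0,±2), (4,±6)` are eight distinct rational
   points, so they are all of `E(ℚ)` (`Cremona1997_points_24A1_holds`, counting coordinate pairs).
4. `Kubert1976_no_two_twelve_holds` is then the tree's reduction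
   `Kubert1976_no_two_twelve_of_points_24A1` (`KubertTwoTwelve.lean`: a subgroup `ℤ/2 × ℤ/12`
   yields, through Kubert's parametrisation of `X₁(2,12)`, a ninth rational point of `24A1`).

Classically, steps 1–3 are Fermat's theorem that four squares in arithmetic progression are
trivial (`X₀(24)(ℚ)` = cusps); Kubert's Ch. IV obtains the result from the genus-`1` curve
`X₁(2,12)` in the same way. (The PDF held under Kubert's DOI is the 1979 *Compositio* sequel of
the same title; the 1976 paper itself is not held. Nothing here depends on its text: the
statement discharged is the one vendored in `MazurTorsion.lean`.)

## References

* [Kubert1976] D. S. Kubert, *Universal bounds on the torsion of elliptic curves*, Proc. London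
  Math. Soc. (3) 33 (1976) 193–237, Ch. IV (`X₁(2,10)`, `X₁(2,12)`).
* [Mazur1977] B. Mazur, *Modular curves and the Eisenstein ideal*, Publ. Math. IHÉS 47 (1977),
  Ch. III §5, First reduction, p. 156.
* [CremonaAlgorithms1997] J. E. Cremona, *Algorithms for Modular Elliptic Curves*, 2nd ed., CUP
  1997: Table 1, `N = 24`, curve `A1 = [0, -1, 0, -4, 4]`, `r = 0`, `|T| = 8`; §3.3 (torsion via
  reduction modulo good primes).
* [SilvermanAEC2009] J. H. Silverman, *The Arithmetic of Elliptic Curves*, 2nd ed., GTM 106: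
  Prop. VII.3.1 (torsion injects into the reduction), VII.§2 (reduction modulo `π`),
  Prop. X.1.4 (complete `2`-descent), Thm. VIII.6.7 (Mordell–Weil).

## Design

* Theorems only (no definitions, no new facts). The reduced equation is written literally as
  `(⟨0, -1, 0, -4, 4⟩ : WeierstrassCurve (ZMod ℓ))`, and the `ℓ`-adic absolute value of `ℚ` as
  `(NormedField.valuation.comap (Rat.castHom ℚ_[ℓ]) : Valuation ℚ ℝ≥0)` (`q ↦ ‖q‖_ℓ`, the
  pull-back of the norm valuation of `ℚ_ℓ`; it is the tree's `ratAdicValuation` of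
  `CanonicalPAdicHeightParallelogramProofs.lean`, not imported to keep this arithmetic file
  light); the residue map `ℤ_(ℓ) → ℤ_ℓ → 𝔽_ℓ` (through Mathlib's `PadicInt.toZMod`) is built
  inside the proof of `exists_reduceHom`, the only place where the data of `PointReduction.lean`
  are needed.
* As in `Curve24A1Descent.lean`, statements avoid the group law on points or fix its
  `DecidableEq` instances to the classical ones (`letI := Classical.decEq _` in the statement of
  `exists_reduceHom`), the instances carried by the general theorems of `PointReduction.lean`.
-/

noncomputable section

open scoped NNReal
open WeierstrassCurve WeierstrassCurve.Affine

namespace Literature.NumberTheory.EllipticCurves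

namespace Curve24A1

/-! ### `24A1` modulo `ℓ` and its points over `𝔽₅` and `𝔽₇` -/

/-- `Δ = 2304` for the reduction `[0, -1, 0, -4, 4]` of `24A1` modulo `ℓ` (the same integral
equation read over `ZMod ℓ`; Silverman, *AEC*, VII.§2, `Ẽ`), so that it is an elliptic curve over
`𝔽_ℓ` for `ℓ ∤ 2304 = 2⁸·3²`. [cite: CremonaAlgorithms1997, Table 1, N = 24, curve A1] -/
theorem reduction_Δ (ℓ : ℕ) : (⟨0, -1, 0, -4, 4⟩ : WeierstrassCurve (ZMod ℓ)).Δ = 2304 := by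
  norm_num [WeierstrassCurve.Δ, b₂, b₄, b₆, b₈]

/-- The affine equation of `24A1` modulo `ℓ`: `y² = x³ - x² - 4x + 4`.
[cite: CremonaAlgorithms1997, Table 1, N = 24, curve A1] -/
theorem equation_reduction_iff (ℓ : ℕ) (x y : ZMod ℓ) :
    (⟨0, -1, 0, -4, 4⟩ : WeierstrassCurve (ZMod ℓ)).toAffine.Equation x y ↔
      y ^ 2 = x ^ 3 - x ^ 2 - 4 * x + 4 := by
  rw [Affine.equation_iff]
  constructor <;> intro h <;> linear_combination h

/-- `y² = x³ - x² - 4x + 4` has exactly `7` affine solutions over `𝔽₅`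
(`(0, ±2), (1, 0), (2, 0), (3, 0), (4, ±1)`), by enumeration. [folklore] -/
theorem card_solutions_five :
    Fintype.card {xy : ZMod 5 × ZMod 5 // xy.2 ^ 2 = xy.1 ^ 3 - xy.1 ^ 2 - 4 * xy.1 + 4} = 7 := by
  decide

/-- `y² = x³ - x² - 4x + 4` has exactly `7` affine solutions over `𝔽₇`
(`(0, ±2), (1, 0), (2, 0), (4, ±1), (5, 0)`), by enumeration. [folklore] -/
theorem card_solutions_seven :
    Fintype.card {xy : ZMod 7 × ZMod 7 // xy.2 ^ 2 = xy.1 ^ 3 - xy.1 ^ 2 - 4 * xy.1 + 4} = 7 := by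
  decide

/-- **`#Ẽ(𝔽₅) = 8`** for `E = 24A1` (`7` affine points and `O`; equivalently `a₅ = -2`, Cremona
Table 1/3, `24A1`). [cite: CremonaAlgorithms1997, Table 1, N = 24, curve A1] -/
theorem natCard_point_reduction_five :
    Nat.card (⟨0, -1, 0, -4, 4⟩ : WeierstrassCurve (ZMod 5)).toAffine.Point = 8 := by
  have h2304 : (2304 : ZMod 5) ≠ 0 := by decide
  haveI : Fact (Nat.Prime 5) := ⟨by norm_num⟩
  haveI : (⟨0, -1, 0, -4, 4⟩ : WeierstrassCurve (ZMod 5)).IsElliptic :=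
    ⟨by rw [reduction_Δ]; exact isUnit_iff_ne_zero.mpr h2304⟩
  have e : {xy : ZMod 5 × ZMod 5 //
      (⟨0, -1, 0, -4, 4⟩ : WeierstrassCurve (ZMod 5)).toAffine.Equation xy.1 xy.2} ≃
      {xy : ZMod 5 × ZMod 5 // xy.2 ^ 2 = xy.1 ^ 3 - xy.1 ^ 2 - 4 * xy.1 + 4} :=
    Equiv.subtypeEquivRight fun xy => equation_reduction_iff 5 xy.1 xy.2
  rw [Nat.card_congr (WeierstrassCurve.Affine.pointEquiv
    (⟨0, -1, 0, -4, 4⟩ : WeierstrassCurve (ZMod 5)).toAffine)]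
  change Nat.card (Option _) = 8
  rw [Finite.card_option, Nat.card_congr e, Nat.card_eq_fintype_card, card_solutions_five]

/-- **`#Ẽ(𝔽₇) = 8`** for `E = 24A1` (`7` affine points and `O`; equivalently `a₇ = 0`, Cremona
Table 1/3, `24A1`). [cite: CremonaAlgorithms1997, Table 1, N = 24, curve A1] -/
theorem natCard_point_reduction_seven :
    Nat.card (⟨0, -1, 0, -4, 4⟩ : WeierstrassCurve (ZMod 7)).toAffine.Point = 8 := by
  have h2304 : (2304 : ZMod 7) ≠ 0 := by decide
  haveI : Fact (Nat.Prime 7) := ⟨by norm_num⟩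
  haveI : (⟨0, -1, 0, -4, 4⟩ : WeierstrassCurve (ZMod 7)).IsElliptic :=
    ⟨by rw [reduction_Δ]; exact isUnit_iff_ne_zero.mpr h2304⟩
  have e : {xy : ZMod 7 × ZMod 7 //
      (⟨0, -1, 0, -4, 4⟩ : WeierstrassCurve (ZMod 7)).toAffine.Equation xy.1 xy.2} ≃
      {xy : ZMod 7 × ZMod 7 // xy.2 ^ 2 = xy.1 ^ 3 - xy.1 ^ 2 - 4 * xy.1 + 4} :=
    Equiv.subtypeEquivRight fun xy => equation_reduction_iff 7 xy.1 xy.2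
  rw [Nat.card_congr (WeierstrassCurve.Affine.pointEquiv
    (⟨0, -1, 0, -4, 4⟩ : WeierstrassCurve (ZMod 7)).toAffine)]
  change Nat.card (Option _) = 8
  rw [Finite.card_option, Nat.card_congr e, Nat.card_eq_fintype_card, card_solutions_seven]

/-! ### The `ℓ`-adic absolute value of `ℚ`, its valuation ring `ℤ_(ℓ)`, and the reduction map -/

section Local

variable (ℓ : ℕ) [Fact ℓ.Prime]

/-- Integers lie in the valuation ring `ℤ_(ℓ) = {‖q‖_ℓ ≤ 1}` of the `ℓ`-adic absolute value
`q ↦ ‖q‖_ℓ` of `ℚ` (the pull-back of the norm valuation of `ℚ_ℓ`). [folklore] -/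
theorem intCast_mem_integer (z : ℤ) :
    (z : ℚ) ∈ (NormedField.valuation.comap (Rat.castHom ℚ_[ℓ]) : Valuation ℚ ℝ≥0).integer := by
  rw [Valuation.mem_integer_iff, Valuation.comap_apply, ← NNReal.coe_le_coe, NNReal.coe_one]
  change ‖((z : ℚ) : ℚ_[ℓ])‖ ≤ 1
  rw [Rat.cast_intCast]
  exact Padic.norm_int_le_one z

/-- A natural number prime to `ℓ` is an `ℓ`-adic unit: `‖n‖_ℓ = 1`. [folklore] -/
theorem valuation_natCast_eq_one {n : ℕ} (h : ℓ.Coprime n) :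
    (NormedField.valuation.comap (Rat.castHom ℚ_[ℓ]) : Valuation ℚ ℝ≥0) (n : ℚ) = 1 := by
  rw [Valuation.comap_apply, ← NNReal.coe_eq_one]
  change ‖((n : ℚ) : ℚ_[ℓ])‖ = 1
  rw [Rat.cast_natCast]
  exact Padic.norm_natCast_eq_one_iff.mpr h

/-- `24A1` is an `ℓ`-integral equation (its coefficients are integers).
[cite: CremonaAlgorithms1997, Table 1, N = 24, curve A1] -/
theorem isIntegral_curve24A1 :
    curve24A1.IsIntegral
      (NormedField.valuation.comap (Rat.castHom ℚ_[ℓ]) : Valuation ℚ ℝ≥0).integer :=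
  ⟨⟨⟨0, intCast_mem_integer ℓ 0⟩, ⟨-1, intCast_mem_integer ℓ (-1)⟩, ⟨0, intCast_mem_integer ℓ 0⟩,
    ⟨-4, intCast_mem_integer ℓ (-4)⟩, ⟨4, intCast_mem_integer ℓ 4⟩⟩, rfl⟩

/-- **Good reduction**: for `ℓ` prime to `Δ(24A1) = 2304 = 2⁸·3²`, `‖Δ‖_ℓ = 1`.
[cite: CremonaAlgorithms1997, Table 1, N = 24, curve A1] -/
theorem valuation_Δ (h : IsCoprime (2304 : ℤ) ℓ) :
    (NormedField.valuation.comap (Rat.castHom ℚ_[ℓ]) : Valuation ℚ ℝ≥0) curve24A1.Δ = 1 := by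
  rw [curve24A1_Δ, Valuation.comap_apply, ← NNReal.coe_eq_one]
  change ‖((2304 : ℚ) : ℚ_[ℓ])‖ = 1
  rw [show ((2304 : ℚ) : ℚ_[ℓ]) = ((2304 : ℤ) : ℚ_[ℓ]) by norm_cast]
  exact Padic.norm_intCast_eq_one_iff.mpr h

/-- **The prime-to-`ℓ` torsion of `24A1(ℚ)` injects into `Ẽ(𝔽_ℓ)`** at a prime `ℓ` of good
reduction (Silverman, *AEC*, Prop. VII.3.1(b) with Prop. VII.2.1: the reduction map is an
injective homomorphism on the torsion prime to the residue characteristic; here the tree's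
`reduceHom` / `injective_reduceHom` of `PointReduction.lean` for the `ℓ`-adic absolute value of
`ℚ`, the residue map `ℤ_(ℓ) → ℤ_ℓ → 𝔽_ℓ` — the inclusion into `ℤ_ℓ` followed by Mathlib's
`PadicInt.toZMod`, whose kernel is `{‖q‖_ℓ < 1}` (`PadicInt.ker_toZMod`) — and the reduced
equation `[0, -1, 0, -4, 4]` over `𝔽_ℓ`). The group laws are Mathlib's, elaborated against the
classical `DecidableEq` instances (those of `PointReduction.lean`).
[cite: SilvermanAEC2009, Prop. VII.3.1(b)] -/
theorem exists_reduceHom (h : IsCoprime (2304 : ℤ) ℓ) :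
    letI := Classical.decEq ℚ
    letI := Classical.decEq (ZMod ℓ)
    ∃ f : goodTorsion (NormedField.valuation.comap (Rat.castHom ℚ_[ℓ]) : Valuation ℚ ℝ≥0)
        curve24A1 →+ (⟨0, -1, 0, -4, 4⟩ : WeierstrassCurve (ZMod ℓ)).toAffine.Point,
      Function.Injective f := by
  letI := Classical.decEq ℚ
  letI := Classical.decEq (ZMod ℓ)
  set w : Valuation ℚ ℝ≥0 := NormedField.valuation.comap (Rat.castHom ℚ_[ℓ]) with hw
  have hw1 : ∀ q : ℚ, w q ≤ 1 ↔ ‖(q : ℚ_[ℓ])‖ ≤ 1 := fun q => by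
    rw [hw, Valuation.comap_apply, ← NNReal.coe_le_coe, NNReal.coe_one]; rfl
  have hw1' : ∀ q : ℚ, w q < 1 ↔ ‖(q : ℚ_[ℓ])‖ < 1 := fun q => by
    rw [hw, Valuation.comap_apply, ← NNReal.coe_lt_coe, NNReal.coe_one]; rfl
  haveI : curve24A1.IsIntegral w.integer := isIntegral_curve24A1 ℓ
  -- the residue map `ℤ_(ℓ) → ℤ_ℓ → 𝔽_ℓ`
  let ι : w.integer →+* ℤ_[ℓ] :=
    { toFun := fun a => ⟨((a : ℚ) : ℚ_[ℓ]), (hw1 a).mp a.2⟩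
      map_one' := Subtype.ext (by simp)
      map_mul' := fun a b => Subtype.ext (by simp)
      map_zero' := Subtype.ext (by simp)
      map_add' := fun a b => Subtype.ext (by simp) }
  let r : w.integer →+* ZMod ℓ := PadicInt.toZMod.comp ι
  have hr : ∀ a : w.integer, r a = 0 ↔ w (a : ℚ) < 1 := fun a => by
    rw [hw1', RingHom.comp_apply, ← RingHom.mem_ker, PadicInt.ker_toZMod,
      IsLocalRing.mem_maximalIdeal, PadicInt.mem_nonunits, PadicInt.norm_def]
    rfl
  have hΔ : w curve24A1.Δ = 1 := valuation_Δ ℓ h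
  -- the reduced equation
  have hred : reduceCurve r curve24A1 = (⟨0, -1, 0, -4, 4⟩ : WeierstrassCurve (ZMod ℓ)) := by
    ext
    · show reduceFun r (0 : ℚ) = 0
      rw [show (0 : ℚ) = ((0 : ℤ) : ℚ) by norm_num, reduceFun_intCast]; norm_num
    · show reduceFun r (-1 : ℚ) = -1
      rw [show (-1 : ℚ) = ((-1 : ℤ) : ℚ) by norm_num, reduceFun_intCast]; norm_num
    · show reduceFun r (0 : ℚ) = 0
      rw [show (0 : ℚ) = ((0 : ℤ) : ℚ) by norm_num, reduceFun_intCast]; norm_num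
    · show reduceFun r (-4 : ℚ) = -4
      rw [show (-4 : ℚ) = ((-4 : ℤ) : ℚ) by norm_num, reduceFun_intCast]; norm_num
    · show reduceFun r (4 : ℚ) = 4
      rw [show (4 : ℚ) = ((4 : ℤ) : ℚ) by norm_num, reduceFun_intCast]; norm_num
  exact ⟨reduceHom w r hr hΔ hred, injective_reduceHom hr hΔ hred⟩

end Local

/-! ### `#E(ℚ) ≤ 8` by reduction modulo `5` and `7` -/

/-- **`#24A1(ℚ) ≤ 8`** (the bound `|T| ≤ 8` behind Cremona's Table 1 entry `24A1: r = 0,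
|T| = 8`, obtained as in Cremona §3.3 / Silverman, *AEC*, VII.3.1 by reducing modulo good
primes). `E(ℚ)` is finite (`finite_point`), so every point `P` has an order `n = 5ᵃ m`,
`5 ∤ m`; then `mP` is killed by `5ᵃ`, lies in the prime-to-`7` torsion, which injects into
`Ẽ(𝔽₇)` of order `8` (`exists_reduceHom`, `natCard_point_reduction_seven`), so `8mP = 0` and `P`
lies in the prime-to-`5` torsion; the latter injects into `Ẽ(𝔽₅)` of order `8`.
[cite: CremonaAlgorithms1997, Table 1, N = 24, curve A1 (|T| = 8)] -/
theorem natCard_point_le_eight : Nat.card curve24A1.toAffine.Point ≤ 8 := by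
  letI := Classical.decEq ℚ
  letI : DecidableEq (ZMod 5) := Classical.decEq _
  letI : DecidableEq (ZMod 7) := Classical.decEq _
  haveI : Fact (Nat.Prime 5) := ⟨by norm_num⟩
  haveI : Fact (Nat.Prime 7) := ⟨by norm_num⟩
  haveI : Finite curve24A1.toAffine.Point := finite_point
  obtain ⟨f₅, hf₅⟩ := exists_reduceHom 5 (by norm_num [Int.isCoprime_iff_gcd_eq_one])
  obtain ⟨f₇, hf₇⟩ := exists_reduceHom 7 (by norm_num [Int.isCoprime_iff_gcd_eq_one])
  haveI : Finite (⟨0, -1, 0, -4, 4⟩ : WeierstrassCurve (ZMod 5)).toAffine.Point :=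
    Nat.finite_of_card_ne_zero (by rw [natCard_point_reduction_five]; norm_num)
  -- every rational point lies in the prime-to-`5` torsion
  have hgood : ∀ P : curve24A1.toAffine.Point, P ∈ goodTorsion
      (NormedField.valuation.comap (Rat.castHom ℚ_[5]) : Valuation ℚ ℝ≥0) curve24A1 := by
    intro P
    obtain ⟨n, hn, hnP⟩ := isOfFinAddOrder_iff_nsmul_eq_zero.mp (isOfFinAddOrder_of_finite P)
    obtain ⟨a, m, hm, rfl⟩ := Nat.exists_eq_pow_mul_and_not_dvd hn.ne' 5 (by norm_num)
    -- `m • P` is killed by `5 ^ a`, hence lies in the prime-to-`7` torsion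
    have hR : m • P ∈ goodTorsion
        (NormedField.valuation.comap (Rat.castHom ℚ_[7]) : Valuation ℚ ℝ≥0) curve24A1 := by
      refine mem_goodTorsion_of_zsmul_eq_zero (n := ((5 ^ a : ℕ) : ℤ)) ?_ ?_
      · rw [Int.cast_natCast]
        exact valuation_natCast_eq_one 7 (Nat.Coprime.pow_right a (by norm_num))
      · rw [natCast_zsmul, ← mul_nsmul', hnP]
    -- hence is killed by `#Ẽ(𝔽₇) = 8`
    have h8 : 8 • (m • P) = 0 := by
      have key : (8 : ℕ) • (⟨m • P, hR⟩ : goodTorsion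
          (NormedField.valuation.comap (Rat.castHom ℚ_[7]) : Valuation ℚ ℝ≥0) curve24A1) = 0 := by
        apply hf₇
        rw [map_nsmul, map_zero, ← natCard_point_reduction_seven]
        exact card_nsmul_eq_zero'
      have key' := congrArg Subtype.val key
      simpa using key'
    refine mem_goodTorsion_of_zsmul_eq_zero (n := ((8 * m : ℕ) : ℤ)) ?_ ?_
    · rw [Int.cast_natCast]
      refine valuation_natCast_eq_one 5 (Nat.Coprime.mul_right (by norm_num) ?_)
      exact (Nat.Prime.coprime_iff_not_dvd (by norm_num)).mpr hm
    · rw [natCast_zsmul, mul_nsmul', h8]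
  -- so `E(ℚ)` injects into `Ẽ(𝔽₅)`
  have hinj : Function.Injective fun P : curve24A1.toAffine.Point => f₅ ⟨P, hgood P⟩ := by
    intro P Q hPQ
    have := hf₅ hPQ
    simpa using this
  calc Nat.card curve24A1.toAffine.Point
      ≤ Nat.card (⟨0, -1, 0, -4, 4⟩ : WeierstrassCurve (ZMod 5)).toAffine.Point :=
        Nat.card_le_card_of_injective _ hinj
    _ = 8 := natCard_point_reduction_five

end Curve24A1

/-! ### The discharges -/

/-- **Discharge of `Cremona1997_points_24A1`** (Cremona, *Algorithms for Modular Elliptic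
Curves*, Table 1, `N = 24`, curve `A1 = [0, -1, 0, -4, 4]`: `r = 0`, `|T| = 8`): every rational
solution of `y² = x³ - x² - 4x + 4` is one of `(1, 0), (2, 0), (-2, 0), (0, ±2), (4, ±6)`.
Proof: these seven pairs and `O` give eight distinct points of `E(ℚ)`, and `#E(ℚ) ≤ 8`
(`Curve24A1.natCard_point_le_eight`: rank `0` by complete `2`-descent and Mordell–Weil,
`Curve24A1Descent.lean`; torsion bounded by reduction modulo `5` and `7`), so they exhaust
`E(ℚ)` (counted through the injection `P ↦ (x(P), y(P))` into `Option (ℚ × ℚ)`).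
[cite: CremonaAlgorithms1997, Table 1, N = 24, curve A1 (r = 0, |T| = 8)] -/
theorem Cremona1997_points_24A1_holds : Cremona1997_points_24A1 := by
  intro x y hxy
  haveI : curve24A1.IsElliptic := isElliptic_curve24A1
  haveI : Finite curve24A1.toAffine.Point := Curve24A1.finite_point
  letI : Fintype curve24A1.toAffine.Point := Fintype.ofFinite _
  have hns : ∀ {a b : ℚ}, curve24A1.toAffine.Equation a b → curve24A1.toAffine.Nonsingular a b :=
    fun hab => equation_iff_nonsingular.mp hab
  -- coordinates
  let φ : curve24A1.toAffine.Point → Option (ℚ × ℚ) := fun P => match P with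
    | .zero => none
    | .some a b _ => some (a, b)
  have hφ : Function.Injective φ := by
    rintro (_ | ⟨a, b, h⟩) (_ | ⟨a', b', h'⟩) hPQ
    · rfl
    · exact (Option.some_ne_none _ hPQ.symm).elim
    · exact (Option.some_ne_none _ hPQ).elim
    · simp only [φ, Option.some.injEq, Prod.mk.injEq] at hPQ
      obtain ⟨rfl, rfl⟩ := hPQ
      rfl
  -- the eight known points, by coordinates
  let T : Finset (Option (ℚ × ℚ)) :=
    {none, some (1, 0), some (2, 0), some (-2, 0), some (0, 2), some (0, -2), some (4, 6),
      some (4, -6)}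
  have hT : T.card = 8 := by decide
  have hpt : ∀ {a b : ℚ}, curve24A1.toAffine.Equation a b → some (a, b) ∈ Finset.univ.image φ :=
    fun {a b} hab => Finset.mem_image.mpr ⟨.some a b (hns hab), Finset.mem_univ _, rfl⟩
  have hTsub : T ⊆ Finset.univ.image φ := by
    intro t ht
    simp only [T, Finset.mem_insert, Finset.mem_singleton] at ht
    rcases ht with rfl | rfl | rfl | rfl | rfl | rfl | rfl | rfl
    · exact Finset.mem_image.mpr ⟨0, Finset.mem_univ _, rfl⟩
    all_goals exact hpt ((equation_curve24A1_iff _ _).mpr (by norm_num))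
  have hcard : (Finset.univ.image φ).card ≤ T.card := by
    rw [hT]
    calc (Finset.univ.image φ).card ≤ (Finset.univ : Finset curve24A1.toAffine.Point).card :=
          Finset.card_image_le
      _ = Nat.card curve24A1.toAffine.Point := by
          rw [Finset.card_univ, Nat.card_eq_fintype_card]
      _ ≤ 8 := Curve24A1.natCard_point_le_eight
  have heq : T = Finset.univ.image φ := Finset.eq_of_subset_of_card_le hTsub hcard
  have hmem : φ (.some x y (hns hxy)) ∈ T := by
    rw [heq]
    exact Finset.mem_image_of_mem φ (Finset.mem_univ (Affine.Point.some x y (hns hxy)))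
  simp only [T, φ, Finset.mem_insert, Finset.mem_singleton, Option.some.injEq, Prod.mk.injEq,
    reduceCtorEq, false_or] at hmem
  rcases hmem with ⟨rfl, rfl⟩ | ⟨rfl, rfl⟩ | ⟨rfl, rfl⟩ | ⟨rfl, rfl⟩ | ⟨rfl, rfl⟩ | ⟨rfl, rfl⟩ |
    ⟨rfl, rfl⟩
  · exact Or.inl ⟨rfl, Or.inl rfl⟩
  · exact Or.inl ⟨rfl, Or.inr (Or.inl rfl)⟩
  · exact Or.inl ⟨rfl, Or.inr (Or.inr rfl)⟩
  · exact Or.inr (Or.inl ⟨rfl, Or.inl rfl⟩)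
  · exact Or.inr (Or.inl ⟨rfl, Or.inr rfl⟩)
  · exact Or.inr (Or.inr ⟨rfl, Or.inl rfl⟩)
  · exact Or.inr (Or.inr ⟨rfl, Or.inr rfl⟩)

/-- **Discharge of Kubert (1976), no `ℤ/2ℤ × ℤ/12ℤ` in `E(ℚ)`** (D. S. Kubert, *Universal bounds
on the torsion of elliptic curves*, Proc. London Math. Soc. (3) 33 (1976) 193–237, Ch. IV:
`X₁(2,12)(ℚ)` is cuspidal; invoked by Mazur 1977, Ch. III §5, First reduction, p. 156): for
every Weierstrass curve `W/ℚ`, `Kubert1976_no_two_twelve W`. Proof: the tree's reduction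
`Kubert1976_no_two_twelve_of_points_24A1` (`KubertTwoTwelve.lean`: a subgroup `ℤ/2ℤ × ℤ/12ℤ`
of `E(ℚ)` produces a rational point of `24A1 = X₀(24)` outside its eight torsion points) and
`Cremona1997_points_24A1_holds`.
[cite: Kubert1976, Ch. IV (rational points of X₁(2,12)); Mazur1977, Ch. III §5 p. 156] -/
theorem Kubert1976_no_two_twelve_holds (W : WeierstrassCurve ℚ) : Kubert1976_no_two_twelve W :=
  Kubert1976_no_two_twelve_of_points_24A1 Cremona1997_points_24A1_holds W

end Literature.NumberTheory.EllipticCurves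

end
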